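import Mathlib.Analysis.SpecialFunctions.Pow.Integral
import Mathlib.Analysis.SpecialFunctions.Pow.Continuity
import Mathlib.Analysis.SpecialFunctions.Pow.Asymptotics
import Mathlib.Analysis.Normed.Module.Ball.Pointwise
import Mathlib.Analysis.Calculus.BumpFunction.InnerProduct
import Mathlib.MeasureTheory.Function.L2Space
import Mathlib.MeasureTheory.Group.LIntegral
import Mathlib.MeasureTheory.Measure.Haar.NormedSpace
import Mathlib.MeasureTheory.Integral.Bochner.Set
import Mathlib.Topology.MetricSpace.ProperSpace
import Literature.Analysis.FluidPDE.CollapseDebris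
import Literature.Analysis.FluidPDE.BiotSavartCurlPair
import Literature.Analysis.FunctionSpaces.FlatTorusProofs
import Literature.Analysis.FunctionSpaces.TorusTestFunction
import HarnessLib

/-!
# Point-collapse debris: Kelvin scaling, the `|z|^{-α}` law, finite energy, weak divergence

Proofs file (no new definitions, no named facts) for the objects of
`Literature.Analysis.FluidPDE.CollapseDebris` (notion `collapseDebris` of route
`Summit.AnomalousDissipation.AnomalousDissipation.Theses.DebrisQuanta`): the homogeneous field
`U_{α,W} = CollapseDebris.homogeneousField α W = curl (|z|^{1-α} W(z/|z|))`, the truncated debris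
field `F_{α,W} = CollapseDebris.field α W = curl Φ` on `ℝ³` (`Φ = CollapseDebris.potential α W`)
and the debris datum `D_{α,W} = collapseDebris α W` on `T³`. Together, Parts I–II give the datum
class asserted by the route item `DebrisDatumRegular` (i): for `0 < α < 3/2` and an admissible
profile, `D_{α,W} ∈ L²(T³)` and `D_{α,W}` is weakly divergence free (here for every `C¹` profile,
`L²` for `α < 3/2`, weak divergence-freeness for `α < 3`).

## Part I — scaling, size, energy

* **Kelvin scaling** (`homogeneousPotential_smul`, `fderiv_homogeneousPotential_smul`,
  `homogeneousField_smul`): `Φ₀(cz) = c^{1-α} Φ₀(z)` and `U_{α,W}(cz) = c^{-α} U_{α,W}(z)` for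
  every `c > 0` and *every* `z` and `W` (no differentiability hypothesis: both sides carry the
  same junk value where `Φ₀` is not differentiable) — the degree-`(-α)` homogeneity of
  Shvydkoy's ansatz `u(x) = |x|^{-α}(v + f n)` (Shvydkoy, §1 eq. (2)) and the scaling behind the
  route's inner variables `x - a = λ y`; radial form `‖U(z)‖ = |z|^{-α} ‖U(z/|z|)‖`
  (`norm_homogeneousField_eq`).
* **The `|z|^{-α}` law** (`exists_norm_homogeneousField_le`, `exists_norm_field_le`): for a `C¹`
  profile, `‖U_{α,W}(z)‖ ≤ M |z|^{-α}` and `‖F_{α,W}(z)‖ ≤ C |z|^{-α}` for all `z ≠ 0`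
  (`M = sup_{S²} ‖U‖`; on the transition shell `1/8 ≤ |z| ≤ 1/4` by compactness).
* **Finite energy** (`integrable_sq_norm_field`, `memLp_two_field`, `memLp_two_collapseDebris`,
  `integrable_collapseDebris`): for `α < 3/2` and a `C¹` profile, `F_{α,W} ∈ L²(ℝ³)` and
  `D_{α,W} ∈ L²(T³)` (Mathlib's `integrableOn_ball_of_norm_le_rpow` with exponent `2α < 3`, then
  the unit-cube/torus dictionary `Torus.setLIntegral_unitCube_lift`).
* **Shell energy** (`setIntegral_ball_sq_norm_homogeneousField`,
  `setIntegral_ball_sq_norm_field`): `∫_{B_ρ} ‖U‖² = ρ^{3-2α} ∫_{B_1} ‖U‖²` for every `ρ > 0`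
  (exact Kelvin scaling; the energy-measure dimension `N - 2α` of Bronzi–Shvydkoy, Thm. 1.1 /
  Rem. 1.2: `∫_{|y|<L} |v|² ≍ L^{N-2α}`), and the same for `F_{α,W}` on `ρ ≤ 1/8`.
* **Non-vacuity / one-point singularity** (`homogeneousField_smul_ne_zero`,
  `IsAdmissibleProfile.exists_field_ne_zero`, `collapseDebris_ne_zero`,
  `IsAdmissibleProfile.exists_lt_norm_collapseDebris`): for an admissible profile the debris
  datum is not the zero field, and for `α > 0` it is unbounded near the centre (so it is not
  a.e. equal to any continuous field there — the feature by which the route evades the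
  classical-Euler-limit barrier).

## Part II — weak divergence-freeness (removable point singularity)

* `integrable_field`: `F_{α,W} ∈ L¹(ℝ³)` for `α < 3`; `exists_norm_potential_le`:
  `‖Φ(z)‖ ≤ M |z|^{1-α}`.
* `isWeaklyDivFree_field`: for `α < 3` and a `C¹` profile, `∫ ⟪F_{α,W}, ∇g⟫ = 0` for every test
  function `g ∈ C_c^∞(ℝ³)` (`Literature.Analysis.FluidPDE.IsWeaklyDivFree`). Proof (the standard
  cut-off argument for a point of zero capacity, as behind Evans §5.2.1): with a smooth `ρ_t`,
  `ρ_t = 0` on `B(0,1/t)`, `ρ_t = 1` off `B(0,2/t)`, `|∇ρ_t| ≤ K t`, the field `ρ_t Φ` is `C¹`,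
  so `∫ ⟪curl (ρ_t Φ), ∇g⟫ = 0` by the tree's `isWeaklyDivFree_curl`; by the Leibniz rule
  `curl (ρ_t Φ) = ρ_t curl Φ + ∇ρ_t × Φ` (`curl_smul`; `inner_curl_sub_inner_curl_cutoff_smul`)
  the difference `⟪F, ∇g⟫ - ⟪curl (ρ_t Φ), ∇g⟫` is supported in `B̄(0,2/t)` and dominated
  there, uniformly in `t`, by the integrable majorant `‖∇g‖_∞ (‖F‖ + 2‖curlCLM‖ K M |z|^{-α})`
  (`|∇ρ_t(z)| ≤ K t ≤ 2K/|z|` on the shell), whose integral over `B̄(0,2/t)` tends to `0`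
  (`tendsto_setIntegral_of_antitone`, `⋂ₜ B̄(0,2/t) = {0}`).
* `isWeaklyDivFree_collapseDebris`: for `α < 3` and a `C¹` profile, `D_{α,W}` is weakly
  divergence free on `T³` (`Literature.Analysis.FunctionSpaces.Torus.IsWeaklyDivFree`,
  `∫_{T³} ⟪D, ∇θ⟫ = 0` for smooth `θ`): unfold onto the unit cube
  (`Torus.integral_eq_integral_lift_holds`, `gradient_lift`), localise the periodic test
  function with a bump `≡ 1` on `B(centre, 1/2) ⊃ supp F(· - centre)`, translate by `centre`,
  apply `isWeaklyDivFree_field`.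

Tree search (2026-08-15): `CollapseDebris.lean` has the objects, support/smoothness/measurability
and the `periodize` bridge, and explicitly defers `L²`, weak divergence-freeness and shell energy
(this file); Mathlib has `fderiv_comp_smul`, `fderiv_const_smul_field`,
`integrableOn_ball_of_norm_le_rpow`, `Measure.setIntegral_comp_smul_of_pos`,
`tendsto_setIntegral_of_antitone`, `ContDiffBump`; the tree has `isWeaklyDivFree_curl`
(`BiotSavartCurlPair`, `C¹` fields only), `curl_smul` / `norm_curlCLM_smulRight_le`
(`VorticityCalculus`), `integrableOn_ball_norm_rpow_neg` (`NewtonPotentialHolder`, scalar only),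
`isWeaklyDivFree_cutoff_conePotential` (`DivFreeVectorPotential`, a different cut-off statement);
nothing for curls of potentials with a point singularity, no scaling API for `homogeneousField`.

## References

* R. Shvydkoy, *Homogeneous solutions to the 3D Euler system*, Trans. Amer. Math. Soc. 370
  (2018) 2517–2535, arXiv:1510.03378, §1 eq. (2) (key `Shvydkoy2017`).
* A. Bronzi, R. Shvydkoy, *On the energy behavior of locally self-similar blowup for the Euler
  equation*, Indiana Univ. Math. J. 64 (2015), arXiv:1310.8611, Thm. 1.1, Rem. 1.2
  (key `BronziShvydkoy2015`).
* L. C. Evans, *Partial Differential Equations*, 2nd ed. (2010), §5.2.1 (weak derivatives,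
  `C_c^∞` test functions).
* R. Temam, *Navier–Stokes Equations* (1977), Ch. I §1.4 (the space `H`, weak divergence).
-/

noncomputable section

open MeasureTheory Set Function Filter Topology Metric InnerProductSpace
open scoped ContDiff ENNReal Pointwise RealInnerProductSpace

namespace Literature.Analysis.FluidPDE

/-- Local notation for physical space `ℝ³ = EuclideanSpace ℝ (Fin 3)`. -/
local notation "ℝ³" => EuclideanSpace ℝ (Fin 3)

namespace CollapseDebris

/-! ## Kelvin scaling (degree `1 - α` potential, degree `-α` field) -/

/-- **Homogeneity of the potential**: `Φ₀(c z) = c^{1-α} Φ₀(z)` for `c > 0`, for every `z`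
(at `z = 0` both sides are the junk value `0^{1-α} • W 0`, scaled consistently).
[cite: Shvydkoy2017, §1 eq. (2)] -/
theorem homogeneousPotential_smul (α : ℝ) (W : ℝ³ → ℝ³) {c : ℝ} (hc : 0 < c) (z : ℝ³) :
    homogeneousPotential α W (c • z) = c ^ (1 - α) • homogeneousPotential α W z := by
  have h1 : ‖c • z‖ = c * ‖z‖ := by rw [norm_smul, Real.norm_of_nonneg hc.le]
  have h2 : ‖c • z‖⁻¹ • (c • z) = ‖z‖⁻¹ • z := by
    rw [h1, smul_smul, mul_inv_rev, mul_assoc, inv_mul_cancel₀ hc.ne', mul_one]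
  unfold homogeneousPotential
  rw [h2, h1, Real.mul_rpow hc.le (norm_nonneg z), mul_smul]

/-- **Homogeneity of the Jacobian**: `DΦ₀(c z) = c^{-α} DΦ₀(z)` for `c > 0`, with no
differentiability hypothesis (Mathlib's unconditional `fderiv_comp_smul` /
`fderiv_const_smul_field`: `Φ₀ ∘ (c • ·)` is differentiable at `z` iff `Φ₀` is at `c z`, so the
junk values match). [folklore] -/
theorem fderiv_homogeneousPotential_smul (α : ℝ) (W : ℝ³ → ℝ³) {c : ℝ} (hc : 0 < c) (z : ℝ³) :
    fderiv ℝ (homogeneousPotential α W) (c • z) =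
      c ^ (-α) • fderiv ℝ (homogeneousPotential α W) z := by
  have hfun : (fun y => homogeneousPotential α W (c • y)) =
      c ^ (1 - α) • homogeneousPotential α W :=
    funext fun y => homogeneousPotential_smul α W hc y
  have h1 : fderiv ℝ (fun y => homogeneousPotential α W (c • y)) z =
      c • fderiv ℝ (homogeneousPotential α W) (c • z) := fderiv_comp_smul c
  rw [hfun, fderiv_const_smul_field, Pi.smul_apply] at h1
  -- `h1 : c ^ (1 - α) • DΦ₀ z = c • DΦ₀ (c • z)`; divide by `c`.
  have h2 := congrArg (fun A => c⁻¹ • A) h1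
  simp only [smul_smul, inv_mul_cancel₀ hc.ne', one_smul] at h2
  rw [← h2]
  congr 1
  rw [← Real.rpow_neg_one, ← Real.rpow_add hc]
  congr 1
  ring

/-- **Kelvin scaling of the homogeneous field**: `U_{α,W}(c z) = c^{-α} U_{α,W}(z)` for every
`c > 0`, every `z` and every profile `W` — the degree-`(-α)` homogeneity of Shvydkoy's ansatz
`u = |x|^{-α}(v + f n)`. [cite: Shvydkoy2017, §1 eq. (2)] -/
theorem homogeneousField_smul (α : ℝ) (W : ℝ³ → ℝ³) {c : ℝ} (hc : 0 < c) (z : ℝ³) :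
    homogeneousField α W (c • z) = c ^ (-α) • homogeneousField α W z := by
  rw [homogeneousField, curl_eq_curlCLM, curl_eq_curlCLM,
    fderiv_homogeneousPotential_smul α W hc z, map_smul]

/-- Radial form of the scaling: `U(z) = |z|^{-α} • U(z/|z|)` for `z ≠ 0`. [folklore] -/
theorem homogeneousField_eq_norm_rpow_smul (α : ℝ) (W : ℝ³ → ℝ³) {z : ℝ³} (hz : z ≠ 0) :
    homogeneousField α W z = ‖z‖ ^ (-α) • homogeneousField α W (‖z‖⁻¹ • z) := by
  have hn : 0 < ‖z‖ := norm_pos_iff.2 hz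
  conv_lhs => rw [show z = ‖z‖ • (‖z‖⁻¹ • z) by
    rw [smul_smul, mul_inv_cancel₀ hn.ne', one_smul]]
  exact homogeneousField_smul α W hn _

/-- `‖U(z)‖ = |z|^{-α} ‖U(z/|z|)‖` for `z ≠ 0`. [folklore] -/
theorem norm_homogeneousField_eq (α : ℝ) (W : ℝ³ → ℝ³) {z : ℝ³} (hz : z ≠ 0) :
    ‖homogeneousField α W z‖ = ‖z‖ ^ (-α) * ‖homogeneousField α W (‖z‖⁻¹ • z)‖ := by
  rw [homogeneousField_eq_norm_rpow_smul α W hz, norm_smul,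
    Real.norm_of_nonneg (Real.rpow_nonneg (norm_nonneg _) _)]

/-- Along the ray through a point where `U_{α,W} ≠ 0` the field vanishes nowhere. [folklore] -/
theorem homogeneousField_smul_ne_zero {α : ℝ} {W : ℝ³ → ℝ³} {c : ℝ} (hc : 0 < c) {y : ℝ³}
    (hy : homogeneousField α W y ≠ 0) : homogeneousField α W (c • y) ≠ 0 := by
  rw [homogeneousField_smul α W hc]
  exact smul_ne_zero (Real.rpow_pos_of_pos hc _).ne' hy

/-! ## The `|z|^{-α}` law -/

/-- For a `C¹` profile the homogeneous field is continuous off the origin. [folklore] -/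
theorem continuousOn_homogeneousField {α : ℝ} {W : ℝ³ → ℝ³} (hW : ContDiff ℝ 1 W) :
    ContinuousOn (homogeneousField α W) {0}ᶜ := fun _ hz =>
  (contDiffAt_curl (m := 0) (contDiffAt_homogeneousPotential (α := α) hW hz)
    (by simp)).continuousAt.continuousWithinAt

/-- For a `C¹` profile the debris field is continuous off the origin (the tree's
`continuousOn_field` asks for `C^∞`). [folklore] -/
theorem continuousOn_field_of_contDiff_one {α : ℝ} {W : ℝ³ → ℝ³} (hW : ContDiff ℝ 1 W) :
    ContinuousOn (field α W) {0}ᶜ := fun _ hz =>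
  (contDiffAt_curl (m := 0) (contDiffAt_potential (α := α) (n := 1) hW hz)
    (by simp)).continuousAt.continuousWithinAt

/-- **The `|z|^{-α}` law for `U_{α,W}`**: for a `C¹` profile there is `M ≥ 0` (a bound for
`‖U_{α,W}‖` on the unit sphere, finite by compactness) with `‖U_{α,W}(z)‖ ≤ M |z|^{-α}` for all
`z ≠ 0` (Shvydkoy, §1: `|u(x)| ∼ |x|^{-α}`). [cite: Shvydkoy2017, §1 eq. (2)] -/
theorem exists_norm_homogeneousField_le {α : ℝ} {W : ℝ³ → ℝ³} (hW : ContDiff ℝ 1 W) :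
    ∃ M : ℝ, 0 ≤ M ∧ ∀ z : ℝ³, z ≠ 0 → ‖homogeneousField α W z‖ ≤ M * ‖z‖ ^ (-α) := by
  have hcont : ContinuousOn (homogeneousField α W) (sphere (0 : ℝ³) 1) :=
    (continuousOn_homogeneousField hW).mono fun y hy h0 => by
      rw [mem_singleton_iff] at h0
      rw [h0, mem_sphere_zero_iff_norm, norm_zero] at hy
      exact zero_ne_one hy
  obtain ⟨C, hC⟩ := (isCompact_sphere (0 : ℝ³) 1).exists_bound_of_continuousOn hcont
  refine ⟨max C 0, le_max_right _ _, fun z hz => ?_⟩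
  have hn : 0 < ‖z‖ := norm_pos_iff.2 hz
  have hmem : ‖z‖⁻¹ • z ∈ sphere (0 : ℝ³) 1 := by
    rw [mem_sphere_zero_iff_norm, norm_smul, norm_inv, norm_norm, inv_mul_cancel₀ hn.ne']
  rw [norm_homogeneousField_eq α W hz, mul_comm]
  exact mul_le_mul_of_nonneg_right ((hC _ hmem).trans (le_max_left _ _))
    (Real.rpow_nonneg hn.le _)

/-- **The `|z|^{-α}` law for the debris field**: for a `C¹` profile there is `C ≥ 0` with
`‖F_{α,W}(z)‖ ≤ C |z|^{-α}` for all `z ≠ 0` — homogeneity on the inner ball `|z| < 1/8`,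
continuity on the compact transition shell `1/8 ≤ |z| ≤ 1/4`, zero outside. [folklore] -/
theorem exists_norm_field_le {α : ℝ} {W : ℝ³ → ℝ³} (hW : ContDiff ℝ 1 W) :
    ∃ C : ℝ, 0 ≤ C ∧ ∀ z : ℝ³, z ≠ 0 → ‖field α W z‖ ≤ C * ‖z‖ ^ (-α) := by
  obtain ⟨M, hM0, hM⟩ := exists_norm_homogeneousField_le (α := α) hW
  -- the transition shell
  set A : Set ℝ³ := closedBall (0 : ℝ³) (1 / 4) \ ball 0 (1 / 8) with hA
  have hAc : IsCompact A := (isCompact_closedBall _ _).diff isOpen_ball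
  have hA0 : ∀ z ∈ A, z ≠ 0 := by
    rintro z ⟨-, hz⟩ rfl
    exact hz (mem_ball_self (by norm_num))
  have hg : ContinuousOn (fun z : ℝ³ => ‖z‖ ^ α * ‖field α W z‖) A := by
    intro z hz
    have hz0 := hA0 z hz
    have h1 : ContinuousAt (fun z : ℝ³ => ‖z‖ ^ α) z :=
      continuous_norm.continuousAt.rpow_const (Or.inl (norm_ne_zero_iff.2 hz0))
    have h2 : ContinuousAt (field α W) z :=
      ((continuousOn_field_of_contDiff_one hW) z hz0).continuousAt
        (isOpen_compl_singleton.mem_nhds hz0)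
    exact (h1.mul h2.norm).continuousWithinAt
  obtain ⟨C₁, hC₁⟩ := hAc.exists_bound_of_continuousOn hg
  refine ⟨max M C₁, le_max_of_le_left hM0, fun z hz => ?_⟩
  have hn : 0 < ‖z‖ := norm_pos_iff.2 hz
  have hpow : 0 ≤ ‖z‖ ^ (-α) := Real.rpow_nonneg hn.le _
  rcases lt_or_ge ‖z‖ (1 / 8) with h | h
  · rw [field_eq_homogeneousField h]
    exact (hM z hz).trans (mul_le_mul_of_nonneg_right (le_max_left _ _) hpow)
  rcases le_or_gt ‖z‖ (1 / 4) with h' | h'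
  · have hzA : z ∈ A :=
      ⟨mem_closedBall_zero_iff.2 h', fun hb => not_lt.2 h (mem_ball_zero_iff.1 hb)⟩
    have hb : ‖z‖ ^ α * ‖field α W z‖ ≤ C₁ := by
      have := hC₁ z hzA
      rwa [Real.norm_of_nonneg (mul_nonneg (Real.rpow_nonneg hn.le _) (norm_nonneg _))] at this
    have key : ‖field α W z‖ = ‖z‖ ^ (-α) * (‖z‖ ^ α * ‖field α W z‖) := by
      rw [← mul_assoc, Real.rpow_neg hn.le, inv_mul_cancel₀ (Real.rpow_pos_of_pos hn α).ne',
        one_mul]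
    rw [key, mul_comm]
    exact mul_le_mul_of_nonneg_right (hb.trans (le_max_right _ _)) hpow
  · rw [field_eq_zero h', norm_zero]
    exact mul_nonneg (le_max_of_le_left hM0) hpow

/-! ## Finite energy: `F_{α,W} ∈ L²(ℝ³)` and `D_{α,W} ∈ L²(T³)` for `α < 3/2` -/

/-- **Finite energy on `ℝ³`**: for `α < 3/2` and a `C¹` profile, `‖F_{α,W}‖²` is integrable on
`ℝ³` (`‖F‖² ≤ C² |z|^{-2α}` with `2α < 3` on the unit ball, Mathlib's
`integrableOn_ball_of_norm_le_rpow`; `F = 0` off the ball). This is the finiteness of the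
Bronzi–Shvydkoy shell energy `∫_{|y|<L} |v|² ∼ L^{N-2α}` for `α < N/2`, `N = 3`.
[cite: BronziShvydkoy2015, Thm. 1.1 / Rem. 1.2] -/
theorem integrable_sq_norm_field {α : ℝ} (hα : α < 3 / 2) {W : ℝ³ → ℝ³} (hW : ContDiff ℝ 1 W) :
    Integrable (fun z => ‖field α W z‖ ^ 2) volume := by
  obtain ⟨C, -, hC⟩ := exists_norm_field_le (α := α) hW
  have hmeas : AEStronglyMeasurable (fun z => ‖field α W z‖ ^ 2) volume :=
    ((measurable_field α W).norm.pow_const 2).aestronglyMeasurable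
  have hsupp : support (fun z => ‖field α W z‖ ^ 2) ⊆ ball (0 : ℝ³) 1 := by
    intro z hz
    rw [mem_support] at hz
    rw [mem_ball_zero_iff]
    by_contra h
    exact hz (by rw [field_eq_zero (by linarith [not_lt.1 h])]; simp)
  rw [← integrableOn_iff_integrable_of_support_subset hsupp]
  have h0 : ∀ᵐ z ∂(volume : Measure ℝ³), z ≠ 0 := by
    rw [ae_iff]
    simp
  refine integrableOn_ball_of_norm_le_rpow (by rw [finrank_euclideanSpace_fin]; norm_num)
    (C := C ^ 2) (α := 2 * α) (by rw [finrank_euclideanSpace_fin]; push_cast; linarith)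
    (ae_restrict_of_ae ?_) hmeas
  filter_upwards [h0] with z hz
  have e : (‖z‖ ^ (-α)) ^ 2 = ‖z‖ ^ (-(2 * α)) := by
    rw [← Real.rpow_two, ← Real.rpow_mul (norm_nonneg z)]
    congr 1
    ring
  rw [norm_pow, norm_norm, ← e, ← mul_pow]
  exact pow_le_pow_left₀ (norm_nonneg _) (hC z hz) 2

/-- **`F_{α,W} ∈ L²(ℝ³)`** for `α < 3/2` and a `C¹` profile. [cite: BronziShvydkoy2015, Rem. 1.2] -/
theorem memLp_two_field {α : ℝ} (hα : α < 3 / 2) {W : ℝ³ → ℝ³} (hW : ContDiff ℝ 1 W) :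
    MemLp (field α W) 2 volume :=
  (memLp_two_iff_integrable_sq_norm (measurable_field α W).aestronglyMeasurable).2
    (integrable_sq_norm_field hα hW)

end CollapseDebris

open CollapseDebris

/-- **Finite energy on `T³`**: for `α < 3/2` and a `C¹` profile, `‖D_{α,W}‖²` is integrable on
the torus: `∫_{T³} ‖D‖² = ∫_{[0,1)³} ‖F(y - centre)‖² dy ≤ ∫_{ℝ³} ‖F‖² < ∞`
(`Torus.setLIntegral_unitCube_lift`, `repr ∘ proj = id` on the cube). [folklore] -/
theorem integrable_sq_norm_collapseDebris {α : ℝ} (hα : α < 3 / 2) {W : ℝ³ → ℝ³}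
    (hW : ContDiff ℝ 1 W) :
    Integrable (fun x => ‖collapseDebris α W x‖ ^ 2) volume := by
  set g : ℝ³ → ℝ := fun y => ‖field α W (y - centre)‖ ^ 2 with hg
  have hgi : Integrable g volume := (integrable_sq_norm_field hα hW).comp_sub_right centre
  refine ⟨((measurable_collapseDebris α W).norm.pow_const 2).aestronglyMeasurable, ?_⟩
  rw [hasFiniteIntegral_iff_enorm]
  have hH : AEMeasurable
      (fun x : UnitAddTorus (Fin 3) => ‖‖collapseDebris α W x‖ ^ 2‖ₑ) volume :=
    ((measurable_collapseDebris α W).norm.pow_const 2).enorm.aemeasurable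
  rw [← FunctionSpaces.Torus.setLIntegral_unitCube_lift hH]
  have h2 : EqOn (FunctionSpaces.Torus.lift fun x => ‖‖collapseDebris α W x‖ ^ 2‖ₑ)
      (fun y => ‖g y‖ₑ) (FunctionSpaces.Torus.unitCube (Fin 3)) := by
    intro y hy
    simp only [hg, FunctionSpaces.Torus.lift_apply, collapseDebris_apply,
      FunctionSpaces.Torus.repr_proj_of_mem_unitCube_holds hy]
  calc ∫⁻ y in FunctionSpaces.Torus.unitCube (Fin 3),
        FunctionSpaces.Torus.lift (fun x => ‖‖collapseDebris α W x‖ ^ 2‖ₑ) y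
      = ∫⁻ y in FunctionSpaces.Torus.unitCube (Fin 3), ‖g y‖ₑ :=
        setLIntegral_congr_fun FunctionSpaces.Torus.measurableSet_unitCube h2
    _ ≤ ∫⁻ y, ‖g y‖ₑ := setLIntegral_le_lintegral _ _
    _ < (⊤ : ℝ≥0∞) := hasFiniteIntegral_iff_enorm.1 hgi.hasFiniteIntegral

/-- **`D_{α,W} ∈ L²(T³)`** for `α < 3/2` and a `C¹` profile — conjunct (i)(a) of the route item
`DebrisDatumRegular` (energy-measure dimension `3 - 2α > 0`, Bronzi–Shvydkoy Rem. 1.2).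
[cite: BronziShvydkoy2015, Rem. 1.2] -/
theorem memLp_two_collapseDebris {α : ℝ} (hα : α < 3 / 2) {W : ℝ³ → ℝ³}
    (hW : ContDiff ℝ 1 W) : MemLp (collapseDebris α W) 2 volume :=
  (memLp_two_iff_integrable_sq_norm (aestronglyMeasurable_collapseDebris α W)).2
    (integrable_sq_norm_collapseDebris hα hW)

/-- `D_{α,W} ∈ L¹(T³)` for `α < 3/2` and a `C¹` profile (finite measure). [folklore] -/
theorem integrable_collapseDebris {α : ℝ} (hα : α < 3 / 2) {W : ℝ³ → ℝ³}
    (hW : ContDiff ℝ 1 W) : Integrable (collapseDebris α W) volume :=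
  (memLp_two_collapseDebris hα hW).integrable one_le_two

/-- `D_{α,W} ∈ L²(T³)` for an admissible profile and `α < 3/2`. [folklore] -/
theorem CollapseDebris.IsAdmissibleProfile.memLp_two_collapseDebris {α : ℝ} {W : ℝ³ → ℝ³}
    (h : IsAdmissibleProfile α W) (hα : α < 3 / 2) : MemLp (collapseDebris α W) 2 volume :=
  FluidPDE.memLp_two_collapseDebris hα (h.contDiff.of_le (by exact_mod_cast le_top))

namespace CollapseDebris

/-! ## Shell energy: exact Kelvin scaling -/

/-- **Shell energy of the homogeneous field**: `∫_{B_ρ} ‖U_{α,W}‖² = ρ^{3-2α} ∫_{B_1} ‖U_{α,W}‖²`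
for every `ρ > 0`, every `α` and every profile (change of variables `z = ρ x` and
`U(ρ x) = ρ^{-α} U(x)`; both sides are the junk `0` together when `‖U‖²` is not integrable on
balls). This is the energy-measure dimension `N - 2α` (`N = 3`) of Bronzi–Shvydkoy.
[cite: BronziShvydkoy2015, Thm. 1.1 / Rem. 1.2] -/
theorem setIntegral_ball_sq_norm_homogeneousField (α : ℝ) (W : ℝ³ → ℝ³) {ρ : ℝ} (hρ : 0 < ρ) :
    ∫ z in ball (0 : ℝ³) ρ, ‖homogeneousField α W z‖ ^ 2 =
      ρ ^ (3 - 2 * α) * ∫ z in ball (0 : ℝ³) 1, ‖homogeneousField α W z‖ ^ 2 := by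
  have h := Measure.setIntegral_comp_smul_of_pos volume
    (fun z => ‖homogeneousField α W z‖ ^ 2) (ball (0 : ℝ³) 1) hρ
  rw [smul_unitBall_of_pos hρ, finrank_euclideanSpace_fin, smul_eq_mul] at h
  have e : (ρ ^ (-α)) ^ 2 = ρ ^ (-(2 * α)) := by
    rw [← Real.rpow_two, ← Real.rpow_mul hρ.le]
    congr 1
    ring
  have h2 : (fun x : ℝ³ => ‖homogeneousField α W (ρ • x)‖ ^ 2) =
      fun x => ρ ^ (-(2 * α)) * ‖homogeneousField α W x‖ ^ 2 := by
    funext x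
    rw [homogeneousField_smul α W hρ, norm_smul, mul_pow,
      Real.norm_of_nonneg (Real.rpow_nonneg hρ.le _), e]
  rw [h2, integral_const_mul] at h
  -- `h : ρ^{-2α} ∫_{B_1} ‖U‖² = (ρ³)⁻¹ ∫_{B_ρ} ‖U‖²`
  have hρ3 : (ρ ^ 3 : ℝ) ≠ 0 := pow_ne_zero _ hρ.ne'
  calc ∫ z in ball (0 : ℝ³) ρ, ‖homogeneousField α W z‖ ^ 2
      = ρ ^ 3 * ((ρ ^ 3)⁻¹ * ∫ z in ball (0 : ℝ³) ρ, ‖homogeneousField α W z‖ ^ 2) := by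
        rw [← mul_assoc, mul_inv_cancel₀ hρ3, one_mul]
    _ = ρ ^ 3 * (ρ ^ (-(2 * α)) * ∫ z in ball (0 : ℝ³) 1, ‖homogeneousField α W z‖ ^ 2) := by
        rw [h]
    _ = ρ ^ (3 - 2 * α) * ∫ z in ball (0 : ℝ³) 1, ‖homogeneousField α W z‖ ^ 2 := by
        rw [← mul_assoc]
        congr 1
        rw [show (ρ ^ 3 : ℝ) = ρ ^ (3 : ℝ) by norm_cast, ← Real.rpow_add hρ, sub_eq_add_neg]

/-- **Shell energy of the debris field** below the truncation radius:
`∫_{B_ρ} ‖F_{α,W}‖² = ρ^{3-2α} ∫_{B_1} ‖U_{α,W}‖²` for `0 < ρ ≤ 1/8` (there `F = U`).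
[cite: BronziShvydkoy2015, Rem. 1.2] -/
theorem setIntegral_ball_sq_norm_field (α : ℝ) (W : ℝ³ → ℝ³) {ρ : ℝ} (hρ : 0 < ρ)
    (hρ' : ρ ≤ 1 / 8) :
    ∫ z in ball (0 : ℝ³) ρ, ‖field α W z‖ ^ 2 =
      ρ ^ (3 - 2 * α) * ∫ z in ball (0 : ℝ³) 1, ‖homogeneousField α W z‖ ^ 2 := by
  rw [← setIntegral_ball_sq_norm_homogeneousField α W hρ]
  refine setIntegral_congr_fun measurableSet_ball fun z hz => ?_
  rw [field_eq_homogeneousField ((mem_ball_zero_iff.1 hz).trans_le hρ')]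

/-! ## Non-vacuity and the one-point singularity -/

/-- For an admissible profile the debris field on `ℝ³` is non-zero at points arbitrarily close to
the origin (scale a non-vanishing point of `U_{α,W}` into the inner ball, where `F = U`).
[folklore] -/
theorem IsAdmissibleProfile.exists_field_ne_zero {α : ℝ} {W : ℝ³ → ℝ³}
    (h : IsAdmissibleProfile α W) {ε : ℝ} (hε : 0 < ε) :
    ∃ z : ℝ³, z ≠ 0 ∧ ‖z‖ < ε ∧ field α W z ≠ 0 := by
  obtain ⟨y, hy0, hy⟩ := h.2
  have hyn : 0 < ‖y‖ := norm_pos_iff.2 hy0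
  set c : ℝ := min ε (1 / 8) / (2 * ‖y‖) with hc
  have hm : 0 < min ε (1 / 8) := lt_min hε (by norm_num)
  have hc0 : 0 < c := div_pos hm (by positivity)
  have hnorm : ‖c • y‖ = min ε (1 / 8) / 2 := by
    have hy' : ‖y‖ ≠ 0 := hyn.ne'
    rw [norm_smul, Real.norm_of_nonneg hc0.le, hc]
    field_simp
  refine ⟨c • y, smul_ne_zero hc0.ne' hy0, ?_, ?_⟩
  · rw [hnorm]
    linarith [min_le_left ε (1 / 8)]
  · rw [field_eq_homogeneousField (by rw [hnorm]; linarith [min_le_right ε (1 / 8)])]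
    exact homogeneousField_smul_ne_zero hc0 hy

/-- A point `centre + z` with `‖z‖ < 1/8` lies in the fundamental cube `[0,1)³`. [folklore] -/
theorem centre_add_mem_unitCube {z : ℝ³} (hz : ‖z‖ < 1 / 8) :
    centre + z ∈ FunctionSpaces.Torus.unitCube (Fin 3) := by
  intro i
  have h1 : |z i| ≤ ‖z‖ := by simpa [Real.norm_eq_abs] using PiLp.norm_apply_le z i
  have h2 := abs_le.1 (h1.trans hz.le)
  simp only [PiLp.add_apply, centre_apply, mem_Ico]
  constructor <;> linarith [h2.1, h2.2]

/-- Reading the debris datum at `proj (centre + z)`, `‖z‖ < 1/8`: it is the homogeneous field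
`U_{α,W}(z)`. [folklore] -/
theorem collapseDebris_proj_centre_add {α : ℝ} {W : ℝ³ → ℝ³} {z : ℝ³} (hz : ‖z‖ < 1 / 8) :
    collapseDebris α W (FunctionSpaces.Torus.proj (centre + z)) = homogeneousField α W z := by
  rw [collapseDebris_apply,
    FunctionSpaces.Torus.repr_proj_of_mem_unitCube_holds (centre_add_mem_unitCube hz),
    add_sub_cancel_left, field_eq_homogeneousField hz]

end CollapseDebris

/-- **The debris datum is non-trivial**: for an admissible profile, `D_{α,W} ≠ 0` on `T³`.
[folklore] -/
theorem collapseDebris_ne_zero {α : ℝ} {W : ℝ³ → ℝ³} (h : IsAdmissibleProfile α W) :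
    collapseDebris α W ≠ 0 := by
  obtain ⟨z, -, hzn, hz⟩ := h.exists_field_ne_zero (by norm_num : (0 : ℝ) < 1 / 8)
  intro H
  have := congrFun H (FunctionSpaces.Torus.proj (centre + z))
  rw [collapseDebris_proj_centre_add hzn, Pi.zero_apply] at this
  exact hz (by rwa [field_eq_homogeneousField hzn])

/-- **One-point singularity**: for an admissible profile and `α > 0` the debris datum is
unbounded — `‖D_{α,W}‖` exceeds every constant near the centre (`‖U(s⁻¹ y)‖ = s^α ‖U(y)‖ → ∞`).
In particular `D_{α,W}` is not (a.e. equal to) a continuous field on `T³`, the feature by which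
route DebrisQuanta sits in the evasions of the classical-Euler-limit barrier. [folklore] -/
theorem CollapseDebris.IsAdmissibleProfile.exists_lt_norm_collapseDebris {α : ℝ} {W : ℝ³ → ℝ³}
    (h : IsAdmissibleProfile α W) (hα : 0 < α) (C : ℝ) :
    ∃ x : UnitAddTorus (Fin 3), C < ‖collapseDebris α W x‖ := by
  obtain ⟨y, hy0, hy⟩ := h.2
  have hyn : 0 < ‖y‖ := norm_pos_iff.2 hy0
  have hU : 0 < ‖homogeneousField α W y‖ := norm_pos_iff.2 hy
  -- along `s ↦ s⁻¹ • y`, `s → ∞`: the norm is `s^α ‖U y‖ → ∞` and the point enters `B(0,1/8)`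
  have h1 : ∀ᶠ s : ℝ in atTop, C < s ^ α * ‖homogeneousField α W y‖ :=
    ((tendsto_rpow_atTop hα).atTop_mul_const hU).eventually_gt_atTop C
  have h2 : ∀ᶠ s : ℝ in atTop, 8 * ‖y‖ < s := eventually_gt_atTop _
  have h3 : ∀ᶠ s : ℝ in atTop, 0 < s := eventually_gt_atTop _
  obtain ⟨s, hs1, hs2, hs3⟩ := (h1.and (h2.and h3)).exists
  have hsi : 0 < s⁻¹ := inv_pos.2 hs3
  have hnorm : ‖s⁻¹ • y‖ < 1 / 8 := by
    rw [norm_smul, norm_inv, Real.norm_of_nonneg hs3.le, inv_mul_lt_iff₀ hs3]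
    linarith
  refine ⟨FunctionSpaces.Torus.proj (centre + s⁻¹ • y), ?_⟩
  rw [collapseDebris_proj_centre_add hnorm, homogeneousField_smul α W hsi, norm_smul,
    Real.norm_of_nonneg (Real.rpow_nonneg hsi.le _), Real.inv_rpow hs3.le, Real.rpow_neg hs3.le,
    inv_inv]
  exact hs1

/-! # Part II — weak divergence-freeness: the point singularity of the potential is removable -/

namespace CollapseDebris

/-! ## Size of the potential and integrability of the field -/

/-- `‖Φ(z)‖ ≤ M |z|^{1-α}` off the origin, `M` a bound for `‖W‖` on the unit sphere
(`0 ≤ χ ≤ 1`). [folklore] -/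
theorem exists_norm_potential_le {α : ℝ} {W : ℝ³ → ℝ³} (hW : Continuous W) :
    ∃ M : ℝ, 0 ≤ M ∧ ∀ z : ℝ³, z ≠ 0 → ‖potential α W z‖ ≤ M * ‖z‖ ^ (1 - α) := by
  obtain ⟨C, hC⟩ := (isCompact_sphere (0 : ℝ³) 1).exists_bound_of_continuousOn hW.continuousOn
  refine ⟨max C 0, le_max_right _ _, fun z hz => ?_⟩
  have hn : 0 < ‖z‖ := norm_pos_iff.2 hz
  have hmem : ‖z‖⁻¹ • z ∈ sphere (0 : ℝ³) 1 := by
    rw [mem_sphere_zero_iff_norm, norm_smul, norm_inv, norm_norm, inv_mul_cancel₀ hn.ne']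
  rw [potential_eq_cutoff_smul, homogeneousPotential, norm_smul, norm_smul,
    Real.norm_of_nonneg (cutoff_nonneg _), Real.norm_of_nonneg (Real.rpow_nonneg hn.le _)]
  calc cutoff ‖z‖ * (‖z‖ ^ (1 - α) * ‖W (‖z‖⁻¹ • z)‖)
      ≤ 1 * (‖z‖ ^ (1 - α) * max C 0) :=
        mul_le_mul (cutoff_le_one _) (mul_le_mul_of_nonneg_left
          ((hC _ hmem).trans (le_max_left _ _)) (Real.rpow_nonneg hn.le _))
          (by positivity) zero_le_one
    _ = max C 0 * ‖z‖ ^ (1 - α) := by ring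

/-- **`F_{α,W} ∈ L¹(ℝ³)`** for `α < 3` and a `C¹` profile (`‖F‖ ≤ C |z|^{-α}` on the unit ball,
zero outside). [folklore] -/
theorem integrable_field {α : ℝ} (hα : α < 3) {W : ℝ³ → ℝ³} (hW : ContDiff ℝ 1 W) :
    Integrable (field α W) volume := by
  obtain ⟨C, -, hC⟩ := exists_norm_field_le (α := α) hW
  have hsupp : support (field α W) ⊆ ball (0 : ℝ³) 1 := by
    intro z hz
    rw [mem_support] at hz
    rw [mem_ball_zero_iff]
    by_contra h
    exact hz (field_eq_zero (by linarith [not_lt.1 h]))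
  rw [← integrableOn_iff_integrable_of_support_subset hsupp]
  have h0 : ∀ᵐ z ∂(volume : Measure ℝ³), z ≠ 0 := by
    rw [ae_iff]
    simp
  exact integrableOn_ball_of_norm_le_rpow (by rw [finrank_euclideanSpace_fin]; norm_num)
    (C := C) (α := α) (by rw [finrank_euclideanSpace_fin]; exact_mod_cast hα)
    (ae_restrict_of_ae (by filter_upwards [h0] with z hz using hC z hz))
    (measurable_field α W).aestronglyMeasurable

/-- `|z|^{-α}` is integrable on balls about the origin of `ℝ³` for `α < 3`. [folklore] -/
theorem integrableOn_ball_norm_rpow_neg' {α : ℝ} (hα : α < 3) (r : ℝ) :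
    IntegrableOn (fun z : ℝ³ => ‖z‖ ^ (-α)) (ball 0 r) volume :=
  integrableOn_ball_of_norm_le_rpow (by rw [finrank_euclideanSpace_fin]; norm_num)
    (C := 1) (α := α) (by rw [finrank_euclideanSpace_fin]; exact_mod_cast hα)
    (Eventually.of_forall fun z => by
      rw [Real.norm_of_nonneg (Real.rpow_nonneg (norm_nonneg _) _), one_mul])
    (continuous_norm.measurable.pow_const _).aestronglyMeasurable

/-! ## The cut-off family `ρ_t(z) = 1 - β(t z)` -/

/-- The pointwise Leibniz estimate behind the removable-singularity argument. Let `β` be a smooth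
bump with `β = 1` on `B̄(0,1)`, `β = 0` off `B(0,2)`, `‖Dβ‖ ≤ K`, and `ρ(z) = 1 - β(t z)`, `t > 0`.
Then for `z ≠ 0` with `Φ` differentiable at `z`:
`⟪curl Φ z, v⟫ - ⟪curl (ρ Φ) z, v⟫ = β(tz) ⟪curl Φ z, v⟫ + t ⟪curlCLM (Dβ(tz) ⊗ Φ z), v⟫`.
[folklore] -/
theorem inner_curl_sub_inner_curl_cutoff_smul (β : ContDiffBump (0 : ℝ³)) {t : ℝ}
    {Φ : ℝ³ → ℝ³} {z : ℝ³} (hΦ : DifferentiableAt ℝ Φ z) (v : ℝ³) :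
    ⟪curl Φ z, v⟫ - ⟪curl (fun y => (1 - β (t • y)) • Φ y) z, v⟫ =
      β (t • z) * ⟪curl Φ z, v⟫ +
        t * ⟪curlCLM ((fderiv ℝ β (t • z)).smulRight (Φ z)), v⟫ := by
  have hβt : DifferentiableAt ℝ (fun y : ℝ³ => (β : ℝ³ → ℝ) (t • y)) z :=
    (β.contDiff.differentiable (n := 1) one_ne_zero).differentiableAt.comp z
      (differentiableAt_id.const_smul t)
  have hρ : DifferentiableAt ℝ (fun y : ℝ³ => 1 - β (t • y)) z :=
    (differentiableAt_const _).sub hβt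
  have hD : fderiv ℝ (fun y : ℝ³ => 1 - β (t • y)) z = -(t • fderiv ℝ β (t • z)) := by
    rw [fderiv_fun_sub (differentiableAt_const _) hβt, fderiv_fun_const, Pi.zero_apply, zero_sub]
    congr 1
    exact fderiv_comp_smul t
  have hlin : ((-(t • fderiv ℝ (β : ℝ³ → ℝ) (t • z))).smulRight (Φ z) : ℝ³ →L[ℝ] ℝ³) =
      -(t • (fderiv ℝ (β : ℝ³ → ℝ) (t • z)).smulRight (Φ z)) := by
    ext w
    simp [ContinuousLinearMap.smulRight_apply, smul_smul]
  rw [curl_smul hρ hΦ, hD, hlin, map_neg, map_smul, inner_add_left, real_inner_smul_left,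
    inner_neg_left, real_inner_smul_left]
  ring

end CollapseDebris

open CollapseDebris

/-- **The debris field is weakly divergence free on `ℝ³`**: for `α < 3` and a `C¹` profile,
`∫ ⟪F_{α,W}, ∇g⟫ = 0` for every test function `g ∈ C_c^∞(ℝ³)` — the point singularity of the
potential `Φ` (`|Φ| ≲ |z|^{1-α}`, `|curl Φ| ≲ |z|^{-α}`, both locally integrable) is removable
for the identity `div curl Φ = 0` in `𝒟'`. See the module docstring for the cut-off proof.
[folklore] -/
theorem isWeaklyDivFree_field {α : ℝ} (hα : α < 3) {W : ℝ³ → ℝ³} (hW : ContDiff ℝ 1 W) :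
    IsWeaklyDivFree (field α W) := by
  intro g hg
  -- the test gradient: continuous, compactly supported, bounded by `G`
  have hg2 : ContDiff ℝ 2 g := contDiff_infty.1 hg.contDiff 2
  have hgrad1 : ContDiff ℝ 1 (gradient g) :=
    (InnerProductSpace.toDual ℝ ℝ³).symm.contDiff.comp (hg2.fderiv_right (m := 1) le_rfl)
  have hgradc : HasCompactSupport (gradient g) :=
    (hg.hasCompactSupport.fderiv (𝕜 := ℝ)).comp_left
      (g := (InnerProductSpace.toDual ℝ ℝ³).symm) (map_zero _)
  obtain ⟨G, hG⟩ := hgradc.exists_bound_of_continuous hgrad1.continuous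
  have hG0 : 0 ≤ G := (norm_nonneg _).trans (hG 0)
  -- sizes of `Φ` and `F`
  obtain ⟨M, hM0, hM⟩ := exists_norm_potential_le (α := α) (W := W) hW.continuous
  have hFi : Integrable (field α W) volume := integrable_field hα hW
  -- the fixed bump `β` and the bound `K` on its derivative
  let β : ContDiffBump (0 : ℝ³) := ⟨1, 2, one_pos, one_lt_two⟩
  have hβ1 : ContDiff ℝ 1 (β : ℝ³ → ℝ) := β.contDiff
  obtain ⟨K, hK⟩ := (β.hasCompactSupport.fderiv (𝕜 := ℝ)).exists_bound_of_continuous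
    (hβ1.continuous_fderiv one_ne_zero)
  have hK0 : 0 ≤ K := (norm_nonneg _).trans (hK 0)
  -- the integrand and its value
  set P : ℝ³ → ℝ := fun z => ⟪field α W z, gradient g z⟫ with hP
  have hPi : Integrable P volume := by
    refine (hFi.norm.mul_const G).mono'
      ((measurable_field α W).aestronglyMeasurable.inner hgrad1.continuous.aestronglyMeasurable)
      (Eventually.of_forall fun z => ?_)
    exact (norm_inner_le_norm _ _).trans (mul_le_mul_of_nonneg_left (hG z) (norm_nonneg _))
  -- the majorant
  set H : ℝ³ → ℝ := fun z => G * ‖field α W z‖ + (2 * ‖curlCLM‖ * K * M * G) * ‖z‖ ^ (-α)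
    with hH
  have hHi : IntegrableOn H (closedBall (0 : ℝ³) 2) volume :=
    ((hFi.norm.const_mul G).integrableOn).add
      (((integrableOn_ball_norm_rpow_neg' hα 3).mono_set
        (closedBall_subset_ball (by norm_num))).const_mul _)
  -- the cut fields: for `t ≥ 1`, `ρ_t Φ` is `C¹` and `|P - ⟪curl (ρ_t Φ), ∇g⟫| ≤ 1_{B̄(0,2/t)} H`
  have key : ∀ t : ℝ, 1 ≤ t → ‖∫ z, P z‖ ≤ ∫ z in closedBall (0 : ℝ³) (2 / t), H z := by
    intro t ht
    have ht0 : 0 < t := one_pos.trans_le ht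
    set Ψ : ℝ³ → ℝ³ := fun y => (1 - β (t • y)) • potential α W y with hΨ
    -- `Ψ` is `C¹`: off the origin a product of `C¹` functions, near the origin identically zero
    have hρ : ContDiff ℝ 1 fun y : ℝ³ => 1 - β (t • y) :=
      contDiff_const.sub (hβ1.comp (contDiff_const_smul t))
    have hΨ1 : ContDiff ℝ 1 Ψ := by
      refine contDiff_iff_contDiffAt.2 fun z => ?_
      rcases eq_or_ne z 0 with rfl | hz
      · have hev : Ψ =ᶠ[𝓝 (0 : ℝ³)] fun _ => 0 := by
          have hball : ball (0 : ℝ³) (1 / t) ∈ 𝓝 (0 : ℝ³) := ball_mem_nhds _ (by positivity)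
          filter_upwards [hball] with y hy
          have hty : t • y ∈ closedBall (0 : ℝ³) β.rIn := by
            rw [mem_closedBall_zero_iff, norm_smul, Real.norm_of_nonneg ht0.le]
            rw [mem_ball_zero_iff] at hy
            have : t * ‖y‖ < t * (1 / t) := mul_lt_mul_of_pos_left hy ht0
            rw [mul_one_div_cancel ht0.ne'] at this
            exact this.le
          simp [hΨ, β.one_of_mem_closedBall hty]
        exact (contDiffAt_const (c := (0 : ℝ³))).congr_of_eventuallyEq hev
      · exact (hρ.contDiffAt).smul (contDiffAt_potential (α := α) (n := 1) hW hz)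
    -- weak divergence-freeness of the `C¹` curl
    have h0 : ∫ z, ⟪curl Ψ z, gradient g z⟫ = 0 := isWeaklyDivFree_curl hΨ1 g hg
    have hQi : Integrable (fun z => ⟪curl Ψ z, gradient g z⟫) volume := by
      refine Continuous.integrable_of_hasCompactSupport
        ((continuous_curl hΨ1).inner hgrad1.continuous) (hgradc.mono' ?_)
      intro z hz
      apply subset_tsupport
      simp only [mem_support, ne_eq] at hz ⊢
      intro h
      apply hz
      rw [h, inner_zero_right]
    -- pointwise domination
    have hdom : ∀ᵐ z ∂(volume : Measure ℝ³),
        ‖P z - ⟪curl Ψ z, gradient g z⟫‖ ≤ (closedBall (0 : ℝ³) (2 / t)).indicator H z := by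
      have hne : ∀ᵐ z ∂(volume : Measure ℝ³), z ≠ 0 := by
        rw [ae_iff]
        simp
      filter_upwards [hne] with z hz
      have hzn : 0 < ‖z‖ := norm_pos_iff.2 hz
      have hΦd : DifferentiableAt ℝ (potential α W) z :=
        (contDiffAt_potential (α := α) (n := 1) hW hz).differentiableAt (by simp)
      rw [hP, hΨ, Real.norm_eq_abs]
      change |⟪curl (potential α W) z, gradient g z⟫ -
          ⟪curl (fun y => (1 - β (t • y)) • potential α W y) z, gradient g z⟫| ≤ _
      rw [inner_curl_sub_inner_curl_cutoff_smul β hΦd]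
      by_cases hzt : ‖z‖ ≤ 2 / t
      · -- inside `B̄(0, 2/t)`: Leibniz terms against the majorant
        rw [indicator_of_mem (mem_closedBall_zero_iff.2 hzt), hH]
        have hβle : |β (t • z)| ≤ 1 := by
          rw [abs_of_nonneg (β.nonneg' _)]
          exact β.le_one
        have h1 : |β (t • z) * ⟪curl (potential α W) z, gradient g z⟫| ≤
            G * ‖curl (potential α W) z‖ := by
          rw [abs_mul]
          calc |β (t • z)| * |⟪curl (potential α W) z, gradient g z⟫|
              ≤ 1 * (‖curl (potential α W) z‖ * G) :=
                mul_le_mul hβle ((abs_real_inner_le_norm _ _).trans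
                  (mul_le_mul_of_nonneg_left (hG z) (norm_nonneg _))) (abs_nonneg _) zero_le_one
            _ = G * ‖curl (potential α W) z‖ := by ring
        have hDt : ‖fderiv ℝ (β : ℝ³ → ℝ) (t • z)‖ * t ≤ 2 * K / ‖z‖ := by
          rw [le_div_iff₀ hzn]
          calc ‖fderiv ℝ (β : ℝ³ → ℝ) (t • z)‖ * t * ‖z‖ ≤ K * t * (2 / t) := by
                gcongr
                exact hK _
            _ = 2 * K := by field_simp
        have h2 : |t * ⟪curlCLM ((fderiv ℝ (β : ℝ³ → ℝ) (t • z)).smulRight (potential α W z)),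
            gradient g z⟫| ≤ (2 * ‖curlCLM‖ * K * M * G) * ‖z‖ ^ (-α) := by
          rw [abs_mul, abs_of_nonneg ht0.le]
          calc t * |⟪curlCLM ((fderiv ℝ (β : ℝ³ → ℝ) (t • z)).smulRight (potential α W z)),
                gradient g z⟫|
              ≤ t * (‖curlCLM ((fderiv ℝ (β : ℝ³ → ℝ) (t • z)).smulRight (potential α W z))‖ *
                  ‖gradient g z‖) :=
                mul_le_mul_of_nonneg_left (abs_real_inner_le_norm _ _) ht0.le
            _ ≤ t * ((‖curlCLM‖ * (‖fderiv ℝ (β : ℝ³ → ℝ) (t • z)‖ * ‖potential α W z‖)) * G) := by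
                gcongr
                · exact norm_curlCLM_smulRight_le _ _
                · exact hG z
            _ = ‖curlCLM‖ * G * (‖fderiv ℝ (β : ℝ³ → ℝ) (t • z)‖ * t) * ‖potential α W z‖ := by
                ring
            _ ≤ ‖curlCLM‖ * G * (2 * K / ‖z‖) * (M * ‖z‖ ^ (1 - α)) := by
                gcongr
                exact hM z hz
            _ = (2 * ‖curlCLM‖ * K * M * G) * (‖z‖ ^ (1 - α) / ‖z‖) := by ring
            _ = (2 * ‖curlCLM‖ * K * M * G) * ‖z‖ ^ (-α) := by
                rw [← Real.rpow_sub_one hzn.ne']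
                norm_num
        exact (abs_add_le _ _).trans (add_le_add h1 h2)
      · -- outside: `β(tz) = 0` and `Dβ(tz) = 0`
        push Not at hzt
        have hfar : β.rOut < ‖t • z‖ := by
          rw [norm_smul, Real.norm_of_nonneg ht0.le]
          have : t * (2 / t) < t * ‖z‖ := mul_lt_mul_of_pos_left hzt ht0
          rwa [mul_div_cancel₀ _ ht0.ne'] at this
        have hβ0 : β (t • z) = 0 := β.zero_of_le_dist (by simpa [dist_zero_right] using hfar.le)
        have hDβ0 : fderiv ℝ (β : ℝ³ → ℝ) (t • z) = 0 := by
          apply fderiv_of_notMem_tsupport ℝ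
          rw [β.tsupport_eq, mem_closedBall, dist_zero_right, not_le]
          exact hfar
        rw [indicator_of_notMem (fun h => (not_le.2 hzt) (mem_closedBall_zero_iff.1 h)), hβ0,
          hDβ0]
        simp
    -- integrate
    have hind : Integrable ((closedBall (0 : ℝ³) (2 / t)).indicator H) volume :=
      (hHi.mono_set (closedBall_subset_closedBall
        (by rw [div_le_iff₀ ht0]; linarith))).integrable_indicator measurableSet_closedBall
    calc ‖∫ z, P z‖ = ‖∫ z, (P z - ⟪curl Ψ z, gradient g z⟫)‖ := by
          rw [integral_sub hPi hQi, h0, sub_zero]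
      _ ≤ ∫ z, (closedBall (0 : ℝ³) (2 / t)).indicator H z := norm_integral_le_of_norm_le hind hdom
      _ = ∫ z in closedBall (0 : ℝ³) (2 / t), H z := integral_indicator measurableSet_closedBall
  -- let `t = n + 1 → ∞`: the shrinking balls have the point `0` as intersection
  have hanti : Antitone fun n : ℕ => closedBall (0 : ℝ³) (2 / (n + 1)) := by
    intro m n hmn
    apply closedBall_subset_closedBall
    gcongr
  have hlim := tendsto_setIntegral_of_antitone (μ := volume) (f := H)
    (fun n => measurableSet_closedBall) hanti ⟨0, by simpa using hHi⟩
  have hcap : (⋂ n : ℕ, closedBall (0 : ℝ³) (2 / (n + 1))) = {0} := by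
    apply Subset.antisymm
    · intro z hz
      rw [mem_iInter] at hz
      rw [mem_singleton_iff, ← norm_le_zero_iff]
      refine le_of_forall_pos_le_add fun ε hε => ?_
      obtain ⟨n, hn⟩ := exists_nat_gt (2 / ε)
      have h := mem_closedBall_zero_iff.1 (hz n)
      rw [zero_add]
      refine h.trans ?_
      rw [div_le_iff₀ (by positivity)]
      rw [div_lt_iff₀ hε] at hn
      nlinarith
    · intro z hz
      rw [mem_singleton_iff] at hz
      subst hz
      exact mem_iInter.2 fun n => mem_closedBall_self (by positivity)
  rw [hcap, setIntegral_measure_zero _ (measure_singleton _)] at hlim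
  have hle : ∀ n : ℕ, ‖∫ z, P z‖ ≤ ∫ z in closedBall (0 : ℝ³) (2 / (n + 1)), H z := fun n =>
    key (n + 1) (by simp)
  have h := ge_of_tendsto' hlim hle
  exact norm_le_zero_iff.1 h

/-- **The debris datum is weakly divergence free on `T³`**: for `α < 3` and a `C¹` profile,
`∫_{T³} ⟪D_{α,W}, ∇θ⟫ = 0` for every smooth `θ : T³ → ℝ`
(`Literature.Analysis.FunctionSpaces.Torus.IsWeaklyDivFree`). With `memLp_two_collapseDebris`
this is conjunct (i) of the route item `DebrisDatumRegular`. Proof: the torus integral is the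
integral over the unit cube of `⟪F(y - centre), ∇(lift θ)(y)⟫` (`Torus.integral_eq_integral_lift`,
`gradient_lift`), which extends by zero to `ℝ³`; a bump `η ≡ 1` on `B(centre, 1/2) ⊃ supp F(·-centre)`
localises the periodic test function without changing the integrand; translating by `centre`
reduces to `isWeaklyDivFree_field`. [folklore] -/
theorem isWeaklyDivFree_collapseDebris {α : ℝ} (hα : α < 3) {W : ℝ³ → ℝ³} (hW : ContDiff ℝ 1 W) :
    FunctionSpaces.Torus.IsWeaklyDivFree (collapseDebris α W) := by
  intro θ hθ
  have hΘ : ContDiff ℝ ∞ (FunctionSpaces.Torus.lift θ) := hθ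
  rw [FunctionSpaces.Torus.integral_eq_integral_lift_holds]
  -- on the cube the lifted integrand is `⟪F(y - centre), ∇Θ(y)⟫`
  have h1 : EqOn
      (FunctionSpaces.Torus.lift fun x =>
        ⟪collapseDebris α W x, FunctionSpaces.Torus.gradient θ x⟫)
      (fun y => ⟪field α W (y - centre), gradient (FunctionSpaces.Torus.lift θ) y⟫)
      (FunctionSpaces.Torus.unitCube (Fin 3)) := by
    intro y hy
    simp only [FunctionSpaces.Torus.lift_apply, collapseDebris_apply,
      FunctionSpaces.Torus.repr_proj_of_mem_unitCube_holds hy,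
      FunctionSpaces.Torus.gradient_lift]
  rw [setIntegral_congr_fun FunctionSpaces.Torus.measurableSet_unitCube h1,
    setIntegral_eq_integral_of_forall_compl_eq_zero (fun y hy => by
      rw [field_sub_centre_eq_zero_of_not_mem_openCube α W y
        (fun h => hy fun i => Ioo_subset_Ico_self (h i)), inner_zero_left])]
  -- localise the periodic test function
  let η : ContDiffBump centre := ⟨1 / 2, 1, by norm_num, by norm_num⟩
  set Θ : ℝ³ → ℝ := FunctionSpaces.Torus.lift θ with hΘdef
  have h2 : (fun y => ⟪field α W (y - centre), gradient Θ y⟫) =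
      fun y => ⟪field α W (y - centre), gradient (fun y => η y * Θ y) y⟫ := by
    funext y
    by_cases hy : ‖y - centre‖ < 1 / 2
    · have hev : (fun y => η y * Θ y) =ᶠ[𝓝 y] Θ := by
        filter_upwards [η.eventuallyEq_one_of_mem_ball
          (show y ∈ ball centre η.rIn by rwa [mem_ball_iff_norm])] with w hw
        rw [hw, Pi.one_apply, one_mul]
      rw [gradient, gradient, hev.fderiv_eq]
    · rw [field_eq_zero (by linarith [not_lt.1 hy]), inner_zero_left, inner_zero_left]
  rw [h2, ← integral_add_right_eq_self _ centre]
  simp only [add_sub_cancel_right]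
  -- the translated, localised test function
  have hηΘ : ContDiff ℝ ∞ fun y => η y * Θ y := η.contDiff.mul hΘ
  have hg : FunctionSpaces.IsTestFunctionOn (⊤ : TopologicalSpace.Opens ℝ³)
      (fun y => η (y + centre) * Θ (y + centre)) := by
    refine ⟨hηΘ.comp (contDiff_id.add contDiff_const), ?_, by simp⟩
    have hc : HasCompactSupport fun y => η y * Θ y := η.hasCompactSupport.mul_right
    exact hc.comp_homeomorph (Homeomorph.addRight centre)
  have hgrad : ∀ y : ℝ³, gradient (fun y => η y * Θ y) (y + centre) =
      gradient (fun y => η (y + centre) * Θ (y + centre)) y := fun y => by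
    rw [gradient, gradient, ← fderiv_comp_add_right]
  simp_rw [hgrad]
  exact isWeaklyDivFree_field hα hW _ hg

/-- Weak divergence-freeness of the debris datum of an admissible profile, every `α < 3`.
[folklore] -/
theorem CollapseDebris.IsAdmissibleProfile.isWeaklyDivFree_collapseDebris {α : ℝ} {W : ℝ³ → ℝ³}
    (h : IsAdmissibleProfile α W) (hα : α < 3) :
    FunctionSpaces.Torus.IsWeaklyDivFree (collapseDebris α W) :=
  FluidPDE.isWeaklyDivFree_collapseDebris hα (h.contDiff.of_le (by exact_mod_cast le_top))

end Literature.Analysis.FluidPDE
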